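import Summits.MatrixMultiplication.MatrixMultiplication.Theorems.SaturationLadderSpectralFloor
import Literature.Computability.AlgebraicComplexity.AsymptoticRankMatMul
import HarnessLib

/-!
# Route `SaturationLadder` — spectral floor, chain file 2/2: exactness on ANY leg for little CW, and the
matrix-multiplication base tensor (decomp-mm lens 1 «grading / quantitative ladder», gen 25; route-free helper)

Chain file 1 (`SaturationLadderSpectralFloor`) proved the gauge floor of a certificate
`T^{⊗N} ⊵ ⟨t⟩ ⊗ ⟨q^a,q^b,q^c⟩` on each leg and «exactness forces flatness» on the OUTPUT leg (pair sum `a + c`,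
the binding flattening bound of the THIN shapes `(1,t,r)`, `t ≤ 1 ≤ r`, of the crux `SubexpSaturation`).  The FAR shapes
`(1,k,1)` of the residual side of the route (`TailDescentTwo`: `ω(1,k,1) = k+1`) bind on the two INPUT legs
(`a + b = b + c = k + 1`).  This file records:
* `littleCw_flat_of_exact_maxPair` — for `cw_q` (all three flattening ranks `= q+1`) an `ε`-exact certificate family
  with respect to the BINDING pair sum `max(a+c, a+b, b+c)` — thin, far or cubic — forces `R̃(cw_q) = q + 1`: on the
  `η`-axis the far tight points are as all-or-nothing as the thin ones (gen 24's segment runs from the far point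
  `(1,1,q−1)` to the `α`-point under `Flat(cw_q)`; without flatness no power of `cw_q` certifies either end).
* `flatteningRank_matMulTensor_cube`, `matMul_flat_iff_omega_two` — the dictionary entry for the other base tensor of
  record: `⟨n,n,n⟩` (`n ≥ 2`) is flat, `R̃(⟨n,n,n⟩) = ζ⁽¹⁾(⟨n,n,n⟩) = n²`, IF AND ONLY IF `ω = 2`; so by chain file 1
  exact certificates bootstrapped from powers of a fixed matrix multiplication tensor exist only at the summit itself —
  the flatness test separates the three base families: `CW_q` flat (silent), `⟨n,n,n⟩` flat iff the summit, `cw_q` flat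
  iff Strassen's asymptotic-rank conjecture at `cw_q` (lens-2 aside `LittleCwFlat`).
Support module beneath stmt-MatrixMultiplication-25909; closes no item; imports only BUILT modules.
[cite: ChristandlLeGallLysikovZuiddam2020, Thm. 3.10; ChristandlVranaZuiddam2023, Example 1.4; Strassen1988, §3]
-/

set_option linter.dupNamespace false

noncomputable section

open scoped BigOperators

namespace Summit.MatrixMultiplication.MatrixMultiplication.Theorems.SaturationLadderSpectralFloorLegs

open Literature.Computability.AlgebraicComplexity
open Literature.Barriers.MatrixMultiplication
open Summit.MatrixMultiplication.MatrixMultiplication.Theorems.SaturationLadderSpectralFloor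
  (littleCw_floor asymptoticRank_eq_flatteningRank_of_exact)  -- landed, imported

variable {K : Type} [Field K]

/-! ## 1. Little CW: exactness on the binding leg, whichever it is -/

/-- **Exactness on any leg forces `R̃(cw_q) = q + 1`.** If for every `ε > 0` some power of `cw_{q₀}` (`q₀ ≥ 1`)
degenerates to some `⟨t⟩ ⊗ ⟨q^a,q^b,q^c⟩` (`t ≥ 1`, `q ≥ 2`) whose certified exponent with `r = R̃(cw_{q₀})` is within
the factor `1 + ε` of the BINDING flattening bound `max(a+c, a+b, b+c) ≥ 1`, then `R̃(cw_{q₀}) = q₀ + 1`.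
[cite: ChristandlLeGallLysikovZuiddam2020, Thm. 3.10; CoppersmithWinograd1990, §6] -/
theorem littleCw_flat_of_exact_maxPair {q₀ : ℕ} (hq₀ : 1 ≤ q₀)
    (h : ∀ ε : ℝ, 0 < ε → ∃ N t q a b c : ℕ, 1 ≤ t ∧ 2 ≤ q ∧ 1 ≤ max (a + c) (max (a + b) (b + c)) ∧
      PolyDegeneratesTo (kroneckerPow (cwTensor K q₀) N)
        (kroneckerTensor (unitTensor K t) (matMulTensor K (q ^ a) (q ^ b) (q ^ c))) ∧
      ((N : ℝ) * Real.log (asymptoticRank (cwTensor K q₀)) - Real.log t) / Real.log q ≤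
        (1 + ε) * ((max (a + c) (max (a + b) (b + c)) : ℕ) : ℝ)) :
    asymptoticRank (cwTensor K q₀) = (q₀ : ℝ) + 1 := by
  have hζ : ((flatteningRank (cwTensor K q₀) : ℕ) : ℝ) = (q₀ : ℝ) + 1 := by
    rw [flatteningRank_cwTensor hq₀]; push_cast; ring
  have hZR : (q₀ : ℝ) + 1 ≤ asymptoticRank (cwTensor K q₀) := by
    rw [← hζ]; exact flatteningRank_le_asymptoticRank _
  refine le_antisymm ?_ hZR
  have hZ1 : (1 : ℝ) < (q₀ : ℝ) + 1 := by
    have : (1 : ℝ) ≤ (q₀ : ℝ) := by exact_mod_cast hq₀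
    linarith
  have hZ0 : (0 : ℝ) < (q₀ : ℝ) + 1 := by linarith
  have hR0 : 0 < asymptoticRank (cwTensor K q₀) := hZ0.trans_le hZR
  have hL : 0 < Real.log ((q₀ : ℝ) + 1) := Real.log_pos hZ1
  have hlog : Real.log (asymptoticRank (cwTensor K q₀)) ≤ Real.log ((q₀ : ℝ) + 1) := by
    refine le_of_forall_pos_le_add fun δ hδ => ?_
    obtain ⟨N, t, q, a, b, c, ht, hq, hm, hdeg, hU⟩ := h (δ / Real.log ((q₀ : ℝ) + 1)) (div_pos hδ hL)
    have hfl := littleCw_floor hq₀ hq ht hdeg hZR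
    have hm0 : (0 : ℝ) < ((max (a + c) (max (a + b) (b + c)) : ℕ) : ℝ) := by
      exact_mod_cast (by omega : 0 < max (a + c) (max (a + b) (b + c)))
    have h1 : Real.log (asymptoticRank (cwTensor K q₀)) / Real.log ((q₀ : ℝ) + 1) ≤
        1 + δ / Real.log ((q₀ : ℝ) + 1) := by
      have h2 := hfl.trans hU
      rw [mul_comm (1 + δ / Real.log ((q₀ : ℝ) + 1))] at h2
      exact le_of_mul_le_mul_left h2 hm0
    rw [div_le_iff₀ hL] at h1
    have h3 : (1 + δ / Real.log ((q₀ : ℝ) + 1)) * Real.log ((q₀ : ℝ) + 1) =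
        Real.log ((q₀ : ℝ) + 1) + δ := by field_simp
    linarith [h3]
  exact (Real.log_le_log_iff hR0 hZ0).1 hlog

/-! ## 2. The matrix multiplication tensor as base: flat iff the summit -/

/-- `ζ⁽¹⁾(⟨n,n,n⟩) = n²` (`n ≥ 1`). [cite: ChristandlVranaZuiddam2023, Example 1.4] -/
theorem flatteningRank_matMulTensor_cube {n : ℕ} (hn : 1 ≤ n) :
    (flatteningRank (matMulTensor K n n n) : ℝ) = (n : ℝ) ^ 2 := by
  rw [← gaugePoint₁_eq, gaugePoint₁_matMulTensor (by omega : 0 < n)]; push_cast; ring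

/-- **`⟨n,n,n⟩` is flat iff `ω = 2`** (`n ≥ 2`): `R̃(⟨n,n,n⟩) = n^ω` (tree: `asymptoticRank_matMulTensor`) and
`ζ⁽¹⁾(⟨n,n,n⟩) = n²`.  With chain file 1's `asymptoticRank_eq_flatteningRank_of_exact`: exact certificate families
from powers of a fixed matrix multiplication tensor exist only if `ω = 2`. [cite: ChristandlVranaZuiddam2023, Example 1.4 and Prop. 1.6] -/
theorem matMul_flat_iff_omega_two {n : ℕ} (hn : 2 ≤ n) :
    asymptoticRank (matMulTensor K n n n) = flatteningRank (matMulTensor K n n n) ↔ omega K = 2 := by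
  rw [asymptoticRank_matMulTensor K n (by omega), flatteningRank_matMulTensor_cube (by omega)]
  have hn1 : (1 : ℝ) < n := by exact_mod_cast (by omega : 1 < n)
  have hn0 : (0 : ℝ) < n := by linarith
  have hlog : 0 < Real.log n := Real.log_pos hn1
  constructor
  · intro h
    have h' := congrArg Real.log h
    rw [Real.log_rpow hn0, Real.log_pow] at h'
    push_cast at h'
    have : (omega K - 2) * Real.log n = 0 := by linarith
    rcases mul_eq_zero.1 this with h0 | h0
    · linarith
    · exact absurd h0 hlog.ne'
  · intro h
    rw [h]
    exact_mod_cast Real.rpow_natCast (n : ℝ) 2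

/-- Consequently an `ε`-exact certificate family from powers of `⟨n,n,n⟩` (`n ≥ 2`; exactness on the output leg
`a + c`) exists only if `ω = 2`: bootstrapping exact thin points from a fixed matrix multiplication algorithm is the
summit itself, not a rung below it. [cite: ChristandlLeGallLysikovZuiddam2020, Thm. 3.10; ChristandlVranaZuiddam2023, Prop. 1.6] -/
theorem omega_eq_two_of_exact_matMul_family {n : ℕ} (hn : 2 ≤ n)
    (h : ∀ ε : ℝ, 0 < ε → ∃ N t q a b c : ℕ, 1 ≤ t ∧ 2 ≤ q ∧ 1 ≤ a + c ∧
      PolyDegeneratesTo (kroneckerPow (matMulTensor K n n n) N)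
        (kroneckerTensor (unitTensor K t) (matMulTensor K (q ^ a) (q ^ b) (q ^ c))) ∧
      ((N : ℝ) * Real.log (asymptoticRank (matMulTensor K n n n)) - Real.log t) / Real.log q ≤
        (1 + ε) * ((a + c : ℕ) : ℝ)) :
    omega K = 2 := by
  have hT : 1 < flatteningRank (matMulTensor K n n n) := by
    have h4 : (4 : ℝ) ≤ (flatteningRank (matMulTensor K n n n) : ℝ) := by
      rw [flatteningRank_matMulTensor_cube (by omega)]
      have : (2 : ℝ) ≤ n := by exact_mod_cast hn
      nlinarith
    exact_mod_cast (show (1 : ℝ) < (flatteningRank (matMulTensor K n n n) : ℝ) by linarith)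
  exact (matMul_flat_iff_omega_two hn).1 (asymptoticRank_eq_flatteningRank_of_exact (matMulTensor K n n n) hT h)

end Summit.MatrixMultiplication.MatrixMultiplication.Theorems.SaturationLadderSpectralFloorLegs

end
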